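import Summits.ResolutionOfSingularities.ResolutionOfSingularities.Theorems.HomologicalConductorNoZenoTraceSocleTerminator
import HarnessLib

/-!
# Route `HomologicalConductor`, crux `NoZenoR` (stmt-ResolutionOfSingularities-19943; aside twin
# `NoZeno` 16483): VALUATIVE ABSORPTION — Zariski descent along a Noetherian dominator (toolkit for (NDT-BP), file 2/2)

`[OURS · L W4.4]` Cell res-hironaka, crux chain W4.4, CHAIN v21 §3.10 (planner res-L0-w44-plan-1, ruling (ρ35g)); companion
of `…NoZenoZariskiDescent` (Zariski's base-point budget `Zariski.eventually_not_principalizes`, undivided pencils).  AUTHOR of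
the mathematics and of the original Lean text: res-L0-w44-idea-1 (card 11 `valuative-absorption`, Sketch r12 §n.1–§n.3,
§n.5; all sorry-free there); typed into the tree by res-L0-w44-stub-3 (verbatim modulo namespaces, except that
`exhausts_of_absorbing` runs its descent through a subtype of descent states instead of an auxiliary structure, and the
hierarchy link `vIdealStepAt_of_principalizes` is added).  Nothing here is a statement of the manuscript under review
(Hironaka 2017); AI-written, weaker than expert review.

THE LEVER (idea-1).  `V` is a NOETHERIAN valuation ring of `K` containing every member of an increasing chain of subrings
`D 0 ≤ D 1 ≤ ⋯ ≤ V` with fraction field `K` and DOMINATING each of them.  Zariski's argument («a prime divisor of the second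
kind becomes of the first kind after finitely many quadratic transforms along it») is a DESCENT of the `V`-value of the
denominator of a fixed `u = a/b ∈ V`: blowing up the CENTRE divides `a` and `b` by an element `g` of minimal value.  Along
the ca-thread the blown-up ideals are only `𝔪`-primary, and the descent step survives exactly when the blown-up ideal
ABSORBS the denominator VALUATIVELY (`AbsorbedAt`).  Absorption at cofinally many stages for every denominator forces
`V = ⋃ D m` (`exhausts_of_absorbing`: the strictly descending denominators contradict ACC on principal ideals of `V`,
`TraceSocle.chain_of_isNoetherianRing` — imported from `…NoZenoTraceSocleTerminator`, not restated); a `V`-IDEAL STEP (the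
blown-up ideal contains the `V`-ideal of its own `V`-order, `VIdealStepAt`) absorbs every denominator
(`absorbing_of_vIdealSteps`, window element `t = bⁿ` from the archimedean property `exists_pow_mul_inv_mem`); Zariski's
centre blow-up is a `V`-ideal step (`vIdealStepAt_of_centreStep`, `vIdealStepAt_of_principalizes`).  With one element of
`V` outside every member (in the thread geometry: a unit of the prime divisor whose residue is transcendental over every
`κ(D m)`), NO Noetherian `V` dominates a chain along which `V`-ideal steps recur (`no_chain_of_vIdealSteps`).

HIERARCHY (idea-1 §n.5): centre step ⇒ `V`-ideal step ⇒ absorbing for every denominator ⇒ idea-2's drop multiplier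
(`exists_multiplier_of_absorbedAt`); so the free residual hypotheses nest: «cofinally no drop for the fixed pencil»
(idea-2, `Zariski.Undivided`) ⇒ «cofinally not absorbing / no `V`-ideal step» (this file) ⇒ «cofinally a base point»
(strat-1, (NDT-BP), `Zariski.Principalizes`).
-/

noncomputable section

-- single-problem summit: the doubled namespace component `ResolutionOfSingularities` is forced
set_option linter.dupNamespace false

namespace Summit.ResolutionOfSingularities.ResolutionOfSingularities.Theorems.NoZeno.ZariskiDescent

open Summit.ResolutionOfSingularities.ResolutionOfSingularities.Theorems.NoZeno.TraceSocle (chain_of_isNoetherianRing)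

variable {K : Type} [Field K]

/-! ## The archimedean property of a Noetherian valuation ring -/

/-- **Archimedean property of a Noetherian valuation ring.**  A non-unit `b` of `V` eventually out-values any non-zero
`g ∈ V`: `bⁿ⁺¹ / g ∈ V` for some `n` (else `g/bⁿ` is an infinite chain with unit-free steps, against ACC on principal
ideals, `TraceSocle.chain_of_isNoetherianRing`).  (Author: res-L0-w44-idea-1.) [folklore] -/
theorem exists_pow_mul_inv_mem (V : ValuationSubring K) (hN : IsNoetherianRing V) {b g : K}
    (hb : b ∈ V) (hbi : b⁻¹ ∉ V) (hg : g ∈ V) (hg0 : g ≠ 0) : ∃ n : ℕ, b ^ (n + 1) * g⁻¹ ∈ V := by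
  by_contra h
  push Not at h
  have hb0 : b ≠ 0 := by
    rintro rfl
    exact hbi (by simp)
  have hr : ∀ n, g * (b ^ n)⁻¹ ∈ V ∧ g * (b ^ n)⁻¹ ≠ 0 := by
    intro n
    refine ⟨?_, mul_ne_zero hg0 (inv_ne_zero (pow_ne_zero _ hb0))⟩
    cases n with
    | zero => simpa using hg
    | succ j =>
      rcases V.mem_or_inv_mem (b ^ (j + 1) * g⁻¹) with h1 | h1
      · exact absurd h1 (h j)
      · rw [mul_inv_rev, inv_inv] at h1
        exact h1
  obtain ⟨n, hn⟩ := chain_of_isNoetherianRing V hN (fun n => g * (b ^ n)⁻¹) hr (fun n => by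
    have : g * (b ^ n)⁻¹ * (g * (b ^ (n + 1))⁻¹)⁻¹ = b := by
      field_simp
      ring
    rw [this]
    exact hb)
  have : g * (b ^ (n + 1))⁻¹ * (g * (b ^ n)⁻¹)⁻¹ = b⁻¹ := by
    field_simp
    ring
  rw [this] at hn
  exact hbi hn

/-! ## Valuative absorption and Zariski descent -/

/-- **ABSORPTION of the denominator `b` at stage `m'`.**  There are `t ∈ D m'` and `g` with `ν(t) < ν(g)` (`t / g ∉ V`)
such that every `a ∈ D m'` of value `≥ ν(b t)` (`a / (b t) ∈ V`) has `a / g ∈ D (m'+1)`.  Reading along a blow-up chain: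
`g` generates the transform of the blown-up ideal `J_m'` at the centre of `V`, and `J_m'` contains the `V`-ideal
`{ν ≥ ν(b t)}` — the VALUATIVE GAP of `J_m'` is smaller than the value window available below `ν(g)`.
(Author: res-L0-w44-idea-1.) [this work] -/
def AbsorbedAt (V : ValuationSubring K) (D : ℕ → Subring K) (b : K) (m' : ℕ) : Prop :=
  ∃ t ∈ D m', ∃ g : K, t ≠ 0 ∧ g ≠ 0 ∧ t * g⁻¹ ∉ V ∧
    ∀ a ∈ D m', a * (b * t)⁻¹ ∈ V → a * g⁻¹ ∈ D (m' + 1)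

/-- **VALUATIVELY ABSORBING chain**: every non-unit-of-`V` denominator available at stage `m` is absorbed at some later
stage.  (Author: res-L0-w44-idea-1.) [this work] -/
def Absorbing (V : ValuationSubring K) (D : ℕ → Subring K) : Prop :=
  ∀ m, ∀ b ∈ D m, b ≠ 0 → b⁻¹ ∉ V → ∃ m', m ≤ m' ∧ AbsorbedAt V D b m'

/-- **ZARISKI DESCENT.**  A Noetherian valuation ring dominating an absorbing chain with the same fraction field is
exhausted by it: `V = ⋃ D m`.  Proof: for `u = a/b ∈ V` in no member, absorption rewrites `u = (a t / g) / (b t / g)`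
over a later member with `ν(b t / g) < ν(b)`; iterating (descent states = a stage with a denominator of `u` over it)
gives an infinite chain of denominators with unit-free steps, contradicting `TraceSocle.chain_of_isNoetherianRing`.
The mechanism is Zariski's (prime divisors of the second kind become of the first kind under quadratic transforms).
(Author: res-L0-w44-idea-1.) [this work] -/
theorem exhausts_of_absorbing (V : ValuationSubring K) (hN : IsNoetherianRing V) (D : ℕ → Subring K)
    (hDV : ∀ m, ∀ x ∈ D m, x ∈ V) (hmono : ∀ m m', m ≤ m' → D m ≤ D m')
    (hdom : ∀ m, ∀ x ∈ D m, x⁻¹ ∈ V → x⁻¹ ∈ D m)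
    (hfrac : ∀ u ∈ V, ∃ m, ∃ a ∈ D m, ∃ b ∈ D m, b ≠ 0 ∧ u = a * b⁻¹)
    (hVA : Absorbing V D) : ∀ u ∈ V, ∃ m, u ∈ D m := by
  intro u hu
  by_contra hnot
  push Not at hnot
  obtain ⟨m₀, a₀, ha₀, b₀, hb₀, hb₀0, hu₀⟩ := hfrac u hu
  -- descent states: a stage `q.1` with a denominator `q.2` of `u` over `D q.1`
  let S : Type := {q : ℕ × K // q.2 ∈ D q.1 ∧ q.2 ≠ 0 ∧ ∃ a ∈ D q.1, u = a * q.2⁻¹}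
  have step : ∀ s : S, ∃ s' : S, s.1.2 * (s'.1.2)⁻¹ ∈ V ∧ s'.1.2 * (s.1.2)⁻¹ ∉ V := by
    rintro ⟨⟨m, b⟩, hb, hb0, a, ha, hu'⟩
    have hbi : b⁻¹ ∉ V := fun h => hnot m (by
      have h' := (D m).mul_mem ha (hdom m b hb h)
      rwa [← hu'] at h')
    obtain ⟨m', hmm', t, ht, g, ht0, hg0, htg, habs⟩ := hVA m b hb hb0 hbi
    have ha' : a ∈ D m' := hmono _ _ hmm' ha
    have hb' : b ∈ D m' := hmono _ _ hmm' hb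
    have hbt0 : b * t ≠ 0 := mul_ne_zero hb0 ht0
    have h1 : a * t * g⁻¹ ∈ D (m' + 1) := by
      refine habs _ ((D m').mul_mem ha' ht) ?_
      have : a * t * (b * t)⁻¹ = a * b⁻¹ := by
        field_simp
      rw [this, ← hu']
      exact hu
    have h2 : b * t * g⁻¹ ∈ D (m' + 1) := by
      refine habs _ ((D m').mul_mem hb' ht) ?_
      rw [mul_inv_cancel₀ hbt0]
      exact V.one_mem
    refine ⟨⟨(m' + 1, b * t * g⁻¹), h2, mul_ne_zero hbt0 (inv_ne_zero hg0), a * t * g⁻¹, h1, ?_⟩, ?_, ?_⟩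
    · calc u = a * b⁻¹ := hu'
        _ = a * t * g⁻¹ * (b * t * g⁻¹)⁻¹ := by field_simp
    · show b * (b * t * g⁻¹)⁻¹ ∈ V
      have : b * (b * t * g⁻¹)⁻¹ = (t * g⁻¹)⁻¹ := by
        field_simp
      rw [this]
      rcases V.mem_or_inv_mem (t * g⁻¹) with h | h
      · exact absurd h htg
      · exact h
    · show b * t * g⁻¹ * b⁻¹ ∉ V
      have : b * t * g⁻¹ * b⁻¹ = t * g⁻¹ := by
        field_simp
      rw [this]
      exact htg
  choose F hF using step
  let s₀ : S := ⟨(m₀, b₀), hb₀, hb₀0, a₀, ha₀, hu₀⟩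
  let seq : ℕ → S := fun n => Nat.rec (motive := fun _ => S) s₀ (fun _ s => F s) n
  have hseq : ∀ n, seq (n + 1) = F (seq n) := fun n => rfl
  obtain ⟨n, hn⟩ := chain_of_isNoetherianRing V hN (fun n => (seq n).1.2)
    (fun n => ⟨hDV _ _ (seq n).2.1, (seq n).2.2.1⟩)
    (fun n => by
      show (seq n).1.2 * ((seq (n + 1)).1.2)⁻¹ ∈ V
      rw [hseq]
      exact (hF (seq n)).1)
  have hn' : (seq (n + 1)).1.2 * ((seq n).1.2)⁻¹ ∈ V := hn
  rw [hseq] at hn'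
  exact (hF (seq n)).2 hn'

/-- **Witness form.**  If some element of `V` lies in no member of the chain — in the thread geometry: a unit of the prime
divisor `V` whose residue is transcendental over every residue field `κ(D m)` — then the chain is NOT valuatively
absorbing along `V`.  (Author: res-L0-w44-idea-1.) [this work] -/
theorem not_absorbing_of_witness (V : ValuationSubring K) (hN : IsNoetherianRing V) (D : ℕ → Subring K)
    (hDV : ∀ m, ∀ x ∈ D m, x ∈ V) (hmono : ∀ m m', m ≤ m' → D m ≤ D m')
    (hdom : ∀ m, ∀ x ∈ D m, x⁻¹ ∈ V → x⁻¹ ∈ D m)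
    (hfrac : ∀ u ∈ V, ∃ m, ∃ a ∈ D m, ∃ b ∈ D m, b ≠ 0 ∧ u = a * b⁻¹)
    (w : K) (hw : w ∈ V) (hwn : ∀ m, w ∉ D m) : ¬ Absorbing V D := fun hVA => by
  obtain ⟨m, hm⟩ := exhausts_of_absorbing V hN D hDV hmono hdom hfrac hVA w hw
  exact hwn m hm

/-! ## `V`-ideal steps absorb (Zariski's case and its valuative generalisation) -/

/-- **`V`-IDEAL STEP at stage `m'`**: some non-zero `g ∈ D m'`, a non-unit of `V`, such that every `a ∈ D m'` of value
`≥ ν(g)` has `a / g ∈ D (m'+1)` — i.e. the blown-up ideal CONTAINS THE `V`-IDEAL OF ITS OWN `V`-ORDER and `g` generates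
its transform at the centre of `V`.  (Author: res-L0-w44-idea-1.) [this work] -/
def VIdealStepAt (V : ValuationSubring K) (D : ℕ → Subring K) (m' : ℕ) : Prop :=
  ∃ g ∈ D m', g ≠ 0 ∧ g⁻¹ ∉ V ∧ ∀ a ∈ D m', a * g⁻¹ ∈ V → a * g⁻¹ ∈ D (m' + 1)

/-- **Recurring `V`-ideal steps ⇒ absorbing.**  The window element is `t = bⁿ` with `n` least such that
`ν(bⁿ⁺¹) ≥ ν(g)` (archimedean property of the Noetherian `V`).  (Author: res-L0-w44-idea-1.) [this work] -/
theorem absorbing_of_vIdealSteps (V : ValuationSubring K) (hN : IsNoetherianRing V) (D : ℕ → Subring K)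
    (hDV : ∀ m, ∀ x ∈ D m, x ∈ V) (hmono : ∀ m m', m ≤ m' → D m ≤ D m')
    (hsteps : ∀ m, ∃ m', m ≤ m' ∧ VIdealStepAt V D m') : Absorbing V D := by
  classical
  intro m b hb hb0 hbi
  obtain ⟨m', hmm', g, hg, hg0, hgi, hstep⟩ := hsteps m
  have hbV : b ∈ V := hDV m b hb
  have hgV : g ∈ V := hDV m' g hg
  have hex : ∃ n : ℕ, b ^ (n + 1) * g⁻¹ ∈ V := exists_pow_mul_inv_mem V hN hbV hbi hgV hg0
  set n := Nat.find hex with hn_def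
  have hn : b ^ (n + 1) * g⁻¹ ∈ V := Nat.find_spec hex
  have hlt : b ^ n * g⁻¹ ∉ V := by
    intro h
    by_cases h0 : n = 0
    · rw [h0, pow_zero, one_mul] at h
      exact hgi h
    · obtain ⟨j, hj⟩ := Nat.exists_eq_succ_of_ne_zero h0
      have hPj : b ^ (j + 1) * g⁻¹ ∈ V := by
        rw [show j + 1 = n by omega]
        exact h
      exact Nat.find_min hex (show j < Nat.find hex by rw [← hn_def]; omega) hPj
  refine ⟨m', hmm', b ^ n, (D m').pow_mem (hmono _ _ hmm' hb) n, g, pow_ne_zero _ hb0, hg0, hlt, ?_⟩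
  intro a ha hab
  apply hstep a ha
  have : a * g⁻¹ = a * (b * b ^ n)⁻¹ * (b ^ (n + 1) * g⁻¹) := by
    field_simp
    ring
  rw [this]
  exact V.mul_mem _ _ hab hn

/-- **Zariski's case.**  Blowing up the CENTRE is a `V`-ideal step: if every non-unit of `D m'` divided by a fixed
non-unit-of-`V` element `g ∈ D m'` lands in `D (m'+1)`.  (Author: res-L0-w44-idea-1.) [this work] -/
theorem vIdealStepAt_of_centreStep (V : ValuationSubring K) (D : ℕ → Subring K)
    (hDV : ∀ m, ∀ x ∈ D m, x ∈ V) (m' : ℕ) (g : K) (hg : g ∈ D m') (hg0 : g ≠ 0) (hgi : g⁻¹ ∉ V)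
    (h : ∀ a ∈ D m', a⁻¹ ∉ D m' → a * g⁻¹ ∈ D (m' + 1)) : VIdealStepAt V D m' := by
  refine ⟨g, hg, hg0, hgi, fun a ha hag => ?_⟩
  by_cases ha0 : a = 0
  · rw [ha0, zero_mul]
    exact (D (m' + 1)).zero_mem
  · refine h a ha fun hai => hgi ?_
    have : g⁻¹ = a⁻¹ * (a * g⁻¹) := by
      field_simp
    rw [this]
    exact V.mul_mem _ _ (hDV m' _ hai) hag

/-- **A principalizing step with its generator in the member is a `V`-ideal step** (the link to strat-1's
`Zariski.Principalizes`, whose generator `g` is here required to lie in `D n` and to be non-zero): if `v(g) < 1` and every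
`x ∈ D n` of positive `V`-value is `g·y` with `y ∈ D (n+1)`, then every `a ∈ D n` with `a/g ∈ V` has `a/g ∈ D (n+1)` — for
`v(a) < 1` by the hypothesis, while `v(a) = 1` is impossible (`v(a) ≤ v(g) < 1`). [this work] -/
theorem vIdealStepAt_of_principalizes (V : ValuationSubring K) (D : ℕ → Subring K)
    (hDV : ∀ m, ∀ x ∈ D m, x ∈ V) {n : ℕ} {g : K} (hg : g ∈ D n) (hg0 : g ≠ 0) (hvg : V.valuation g < 1)
    (hdiv : ∀ x ∈ D n, V.valuation x < 1 → ∃ y ∈ D (n + 1), x = g * y) : VIdealStepAt V D n := by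
  refine ⟨g, hg, hg0, fun hgi => ?_, fun a ha hag => ?_⟩
  · have h1 : V.valuation (g⁻¹ * g) < 1 := by
      calc V.valuation (g⁻¹ * g) = V.valuation g⁻¹ * V.valuation g := map_mul _ _ _
        _ ≤ 1 * V.valuation g := mul_le_mul' ((V.valuation_le_one_iff _).mpr hgi) le_rfl
        _ = V.valuation g := one_mul _
        _ < 1 := hvg
    rw [inv_mul_cancel₀ hg0, map_one] at h1
    exact lt_irrefl _ h1
  · rcases V.valuation_lt_one_or_eq_one ⟨a, hDV n a ha⟩ with hva | hva
    · obtain ⟨y, hy, rfl⟩ := hdiv a ha hva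
      rwa [mul_comm g y, mul_inv_cancel_right₀ hg0]
    · exfalso
      have hva' : V.valuation a = 1 := hva
      have hle : V.valuation (a * g⁻¹) ≤ 1 := (V.valuation_le_one_iff _).mpr hag
      have hag' : V.valuation a ≤ V.valuation g := by
        have h := mul_le_mul' hle (le_refl (V.valuation g))
        rwa [one_mul, ← map_mul, inv_mul_cancel_right₀ hg0] at h
      rw [hva'] at hag'
      exact absurd (lt_of_le_of_lt hag' hvg) (lt_irrefl 1)

/-- **Exhaustion from recurring `V`-ideal steps.**  (Author: res-L0-w44-idea-1.) [this work] -/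
theorem exhausts_of_vIdealSteps (V : ValuationSubring K) (hN : IsNoetherianRing V) (D : ℕ → Subring K)
    (hDV : ∀ m, ∀ x ∈ D m, x ∈ V) (hmono : ∀ m m', m ≤ m' → D m ≤ D m')
    (hdom : ∀ m, ∀ x ∈ D m, x⁻¹ ∈ V → x⁻¹ ∈ D m)
    (hfrac : ∀ u ∈ V, ∃ m, ∃ a ∈ D m, ∃ b ∈ D m, b ≠ 0 ∧ u = a * b⁻¹)
    (hsteps : ∀ m, ∃ m', m ≤ m' ∧ VIdealStepAt V D m') : ∀ u ∈ V, ∃ m, u ∈ D m :=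
  exhausts_of_absorbing V hN D hDV hmono hdom hfrac (absorbing_of_vIdealSteps V hN D hDV hmono hsteps)

/-- **No divisorial dominator along recurring `V`-ideal steps.**  A Noetherian valuation ring cannot dominate every
member of a chain with its fraction field along which `V`-ideal steps recur, as soon as one element of `V` lies outside
every member (the residually transcendental unit of the thread geometry).  (Author: res-L0-w44-idea-1.) [this work] -/
theorem no_chain_of_vIdealSteps (V : ValuationSubring K) (hN : IsNoetherianRing V) (D : ℕ → Subring K)
    (hDV : ∀ m, ∀ x ∈ D m, x ∈ V) (hmono : ∀ m m', m ≤ m' → D m ≤ D m')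
    (hdom : ∀ m, ∀ x ∈ D m, x⁻¹ ∈ V → x⁻¹ ∈ D m)
    (hfrac : ∀ u ∈ V, ∃ m, ∃ a ∈ D m, ∃ b ∈ D m, b ≠ 0 ∧ u = a * b⁻¹)
    (hsteps : ∀ m, ∃ m', m ≤ m' ∧ VIdealStepAt V D m')
    (w : K) (hw : w ∈ V) (hwn : ∀ m, w ∉ D m) : False :=
  not_absorbing_of_witness V hN D hDV hmono hdom hfrac w hw hwn
    (absorbing_of_vIdealSteps V hN D hDV hmono hsteps)

/-! ## Hierarchy of step conditions: absorption ⇒ drop multiplier -/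

/-- **ABSORPTION ⇒ DROP MULTIPLIER.**  If the denominator `b` is absorbed at stage `m'`, then every fraction `a/b ∈ V`
with `a ∈ D_m'` acquires a multiplier `u ∉ V` with `u·a, u·b ∈ D_(m'+1)` — idea-2's drop criterion
`(D_(m'+1) :_K (a, b)) ⊄ V`, i.e. the pencil `(a, b)` is NOT `Zariski.Undivided` in `D (m'+1)`.
(Author: res-L0-w44-idea-1.) [this work] -/
theorem exists_multiplier_of_absorbedAt (V : ValuationSubring K) (D : ℕ → Subring K) {b : K} {m' : ℕ}
    (h : AbsorbedAt V D b m') (hb : b ∈ D m') {a : K} (ha : a ∈ D m') (hab : a * b⁻¹ ∈ V) :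
    ∃ u : K, u ∉ V ∧ u * a ∈ D (m' + 1) ∧ u * b ∈ D (m' + 1) := by
  obtain ⟨t, ht, g, ht0, hg0, htg, hall⟩ := h
  refine ⟨t * g⁻¹, htg, ?_, ?_⟩
  · have h1 : a * t * (b * t)⁻¹ ∈ V := by
      by_cases hb0 : b = 0
      · rw [hb0, zero_mul, inv_zero, mul_zero]; exact V.zero_mem
      · rwa [show a * t * (b * t)⁻¹ = a * b⁻¹ by field_simp]
    have := hall (a * t) (mul_mem ha ht) h1
    rwa [show t * g⁻¹ * a = a * t * g⁻¹ by ring]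
  · have h1 : b * t * (b * t)⁻¹ ∈ V := by
      by_cases hbt : b * t = 0
      · rw [hbt, inv_zero, mul_zero]; exact V.zero_mem
      · rw [mul_inv_cancel₀ hbt]; exact V.one_mem
    have := hall (b * t) (mul_mem hb ht) h1
    rwa [show t * g⁻¹ * b = b * t * g⁻¹ by ring]

end Summit.ResolutionOfSingularities.ResolutionOfSingularities.Theorems.NoZeno.ZariskiDescent

end
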